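import Summits.Ventures.HodgeRepro2.T5SU11ResolventCommute
import Summits.Ventures.HodgeRepro2.T5SU11ResolventNeumann
import Summits.Ventures.HodgeRepro2.T5SU11ResolventMonotoneDecay
import Summits.Ventures.HodgeRepro2.T5SU11ResolventWeightedBound
import Summits.Ventures.HodgeRepro2.T5SU11ResolventNeumannSeries
import Summits.Ventures.HodgeRepro2.T5SU11ResolventAnalytic
import Summits.Ventures.HodgeRepro2.T5SU11KernelResolventIdentity
import Summits.Ventures.HodgeRepro2.T5SU11ResolventNeumannBounds
import Summits.Ventures.HodgeRepro2.T5SU11ResolventLipschitz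

/-!
# Summary XII — the resolvent family of the radial Laplacian on the exponentially decaying class
(rows 502–513), under uniform names

The headline statements about the improper Green's operator `G^I_λ` (row 492) of the explicit model, re-exported:

* `resolvent_commute` — `G^I_λ(G^I_{λ₂} g) = G^I_{λ₂}(G^I_λ g)` on the class (row 502);
* `neumann_finite` — `G^I_λ g = Σ_{k≤n} (μ − μ₂)^k (G^I_{λ₂})^{k+1} g + (μ − μ₂)^{n+1} G^I_λ (G^I_{λ₂})^{n+1} g` (row 503);
* `resolvent_nonpos`, `resolvent_mono_lam` — `G^I_λ g ≤ 0` for `g ≥ 0`, and `G^I_{λ₂} g ≤ G^I_λ g` for `λ₂ ≤ λ` (row 504);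
* `weighted_bound` — `∃ c(λ, ε)`, `|G^I_λ g(t)| ≤ c N e^{−εt}` for every `|g| ≤ N e^{−εs}`, `2 − λ < ε < λ` (row 506);
* `neumann_series` — **the Neumann series converges to the resolvent** on the disc `|μ − μ₂| c₂ < 1` (row 507);
* `resolvent_hasDerivAt` — **`d/dλ G^I_λ g(t) = (2λ₂ − 2) · G^I_{λ₂}(G^I_{λ₂} g)(t)`** at `λ₂` (row 508);
* `kernel_resolvent_identity`, `kernel_mono` — **`(μ − μ₂) ∫ K_λ(t,r) K_{λ₂}(r,s) sinh 2r dr = K_λ(t,s) − K_{λ₂}(t,s)`**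
  and `K_{λ₂} ≤ K_λ ≤ 0` for `λ₂ ≤ λ` (row 511);
* `two_sided_bound` — `G^I_{λ₂} g ≤ G^I_λ g ≤ G^I_{λ₂} g + (μ − μ₂) G^I_{λ₂}(G^I_{λ₂} g)` for `g ≥ 0`, `λ₂ ≤ λ` (row 512);
* `resolvent_lipschitz` — `|G^I_λ g(t) − G^I_{λ₂} g(t)| ≤ c₂ · (|μ − μ₂| c₂)/(1 − |μ − μ₂| c₂) · N e^{−εt}` (row 513).

Nothing is claimed about (N).

Blind lane: Mathlib + the HodgeRepro2 prefix only; no sorry; axioms ⊆ {propext, Classical.choice,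
Quot.sound}.
-/

namespace Summit.Ventures.HodgeRepro2.T5SU11RadialSummaryXII

open Filter Topology MeasureTheory
open Set (Ioi Ioc)
open T5SU11Cartan T5SU11SphericalFunction T5SU11SphericalDecay T5SU11RadialGreenImproper T5SU11RadialGreenKernel
  T5SU11ResolventCommute T5SU11ResolventNeumann T5SU11ResolventMonotoneDecay T5SU11ResolventWeightedBound
  T5SU11ResolventNeumannSeries T5SU11ResolventAnalytic T5SU11KernelResolventIdentity T5SU11ResolventNeumannBounds
  T5SU11ResolventLipschitz

section measure

variable [MeasurableSpace Circle] [BorelSpace Circle]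

section class_

variable {lam lam₂ : ℝ} (hlam : 1 < lam) (hlam₂ : 1 < lam₂) {g : ℝ → ℝ} (hg : ContinuousOn g (Ioi 0))
  {M : ℝ} (hM : ∀ s ∈ Ioc (0 : ℝ) 1, |g s| ≤ M) (hM0 : 0 ≤ M)
  {ε C s₀ : ℝ} (hε : 2 - lam < ε) (hε₂ : 2 - lam₂ < ε) (hC : ∀ s, s₀ ≤ s → |g s| ≤ C * Real.exp (-ε * s))

include hlam hlam₂ hg hM hM0 hε hε₂ hC in
/-- **The resolvents commute on the exponentially decaying class** (row 502). -/
theorem resolvent_commute {t : ℝ} (ht : 0 < t) :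
    greenSolI (fun t => sph lam (hyp t)) (sphDecay lam) (greenSolI (fun t => sph lam₂ (hyp t)) (sphDecay lam₂) g) t
      = greenSolI (fun t => sph lam₂ (hyp t)) (sphDecay lam₂)
          (greenSolI (fun t => sph lam (hyp t)) (sphDecay lam) g) t :=
  greenSolI_comm hlam hlam₂ hg hM hM0 hε hε₂ hC ht

include hlam hlam₂ hg hM hM0 hε hε₂ hC in
/-- **The Neumann expansion with exact remainder** (row 503). -/
theorem neumann_finite (n : ℕ) {t : ℝ} (ht : 0 < t) :
    greenSolI (fun t => sph lam (hyp t)) (sphDecay lam) g t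
      = (∑ k ∈ Finset.range (n + 1), (lam * (lam - 2) - lam₂ * (lam₂ - 2)) ^ k
          * (greenSolI (fun t => sph lam₂ (hyp t)) (sphDecay lam₂))^[k + 1] g t)
        + (lam * (lam - 2) - lam₂ * (lam₂ - 2)) ^ (n + 1)
          * greenSolI (fun t => sph lam (hyp t)) (sphDecay lam)
            ((greenSolI (fun t => sph lam₂ (hyp t)) (sphDecay lam₂))^[n + 1] g) t :=
  T5SU11ResolventNeumann.neumann_finite hlam hlam₂ hg hM hM0 hε hε₂ hC n ht

include hlam in
/-- **`G^I_λ g ≤ 0` for a source `g ≥ 0`** (row 504). -/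
theorem resolvent_nonpos (hg0 : ∀ s, 0 < s → 0 ≤ g s) {t : ℝ} (ht : 0 < t) :
    greenSolI (fun t => sph lam (hyp t)) (sphDecay lam) g t ≤ 0 :=
  greenSolI_nonpos hlam hg0 ht

include hlam hlam₂ hg hM hM0 hε hε₂ hC in
/-- **Monotonicity in the spectral parameter**: `G^I_{λ₂} g ≤ G^I_λ g ≤ 0` for `g ≥ 0`, `λ₂ ≤ λ` (row 504). -/
theorem resolvent_mono_lam (hle : lam₂ ≤ lam) (hg0 : ∀ s, 0 < s → 0 ≤ g s) {t : ℝ} (ht : 0 < t) :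
    greenSolI (fun t => sph lam₂ (hyp t)) (sphDecay lam₂) g t
      ≤ greenSolI (fun t => sph lam (hyp t)) (sphDecay lam) g t ∧
    greenSolI (fun t => sph lam (hyp t)) (sphDecay lam) g t ≤ 0 :=
  greenSolI_mono_lam hlam hlam₂ hg hM hM0 hε hε₂ hC hle hg0 ht

include hlam hlam₂ hg hM hM0 hε hε₂ hC in
/-- **The two-sided bound by the first two partial sums** (row 512). -/
theorem two_sided_bound (hle : lam₂ ≤ lam) (hg0 : ∀ s, 0 < s → 0 ≤ g s) {t : ℝ} (ht : 0 < t) :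
    greenSolI (fun t => sph lam₂ (hyp t)) (sphDecay lam₂) g t ≤ greenSolI (fun t => sph lam (hyp t)) (sphDecay lam) g t ∧
    greenSolI (fun t => sph lam (hyp t)) (sphDecay lam) g t
      ≤ greenSolI (fun t => sph lam₂ (hyp t)) (sphDecay lam₂) g t
        + (lam * (lam - 2) - lam₂ * (lam₂ - 2))
          * greenSolI (fun t => sph lam₂ (hyp t)) (sphDecay lam₂)
            (greenSolI (fun t => sph lam₂ (hyp t)) (sphDecay lam₂) g) t :=
  T5SU11ResolventNeumannBounds.two_sided_bound hlam hlam₂ hg hM hM0 hε hε₂ hC hg0 hle ht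

end class_

/-- **The weighted operator bound, uniform in the source** (row 506). -/
theorem weighted_bound {lam ε : ℝ} (hlam : 1 < lam) (hε₁ : 2 - lam < ε) (hε₂ : ε < lam) :
    ∃ c : ℝ, 0 ≤ c ∧ ∀ (g : ℝ → ℝ) (N : ℝ), ContinuousOn g (Ioi 0) → 0 ≤ N →
      (∀ s, 0 < s → |g s| ≤ N * Real.exp (-ε * s)) →
      ∀ t, 0 < t → |greenSolI (fun t => sph lam (hyp t)) (sphDecay lam) g t| ≤ c * N * Real.exp (-ε * t) :=
  exists_abs_greenSolI_le_weighted hlam hε₁ hε₂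

/-- **The Neumann series converges to the resolvent** on the disc `|μ − μ₂| c₂ < 1` (row 507). -/
theorem neumann_series {lam₂ ε : ℝ} (hlam₂ : 1 < lam₂) (hε₂ : 2 - lam₂ < ε) (hε₄ : ε < lam₂) :
    ∃ c₂ : ℝ, 0 ≤ c₂ ∧ ∀ (lam : ℝ), 1 < lam → 2 - lam < ε → ε < lam →
      |lam * (lam - 2) - lam₂ * (lam₂ - 2)| * c₂ < 1 →
      ∀ (g : ℝ → ℝ) (N : ℝ), ContinuousOn g (Ioi 0) → 0 ≤ N → (∀ s, 0 < s → |g s| ≤ N * Real.exp (-ε * s)) →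
      ∀ t, 0 < t → HasSum (fun k : ℕ => (lam * (lam - 2) - lam₂ * (lam₂ - 2)) ^ k
          * (greenSolI (fun t => sph lam₂ (hyp t)) (sphDecay lam₂))^[k + 1] g t)
        (greenSolI (fun t => sph lam (hyp t)) (sphDecay lam) g t) :=
  exists_neumann_radius hlam₂ hε₂ hε₄

/-- **The resolvent is differentiable in the spectral parameter, with derivative the square of the resolvent**
(row 508). -/
theorem resolvent_hasDerivAt {lam₂ ε : ℝ} (hlam₂ : 1 < lam₂) (hε₂ : 2 - lam₂ < ε) (hε₄ : ε < lam₂)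
    {g : ℝ → ℝ} (hg : ContinuousOn g (Ioi 0)) {N : ℝ} (hN0 : 0 ≤ N)
    (hN : ∀ s, 0 < s → |g s| ≤ N * Real.exp (-ε * s)) {t : ℝ} (ht : 0 < t) :
    HasDerivAt (fun lam => greenSolI (fun t => sph lam (hyp t)) (sphDecay lam) g t)
      ((2 * lam₂ - 2) * greenSolI (fun t => sph lam₂ (hyp t)) (sphDecay lam₂)
        (greenSolI (fun t => sph lam₂ (hyp t)) (sphDecay lam₂) g) t) lam₂ :=
  hasDerivAt_greenSolI_lam hlam₂ hε₂ hε₄ hg hN0 hN ht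

/-- **The resolvent is Lipschitz in the spectral parameter in the operator norm of the weighted space** (row 513). -/
theorem resolvent_lipschitz {lam lam₂ ε : ℝ} (hlam : 1 < lam) (hlam₂ : 1 < lam₂) (hε₁ : 2 - lam < ε)
    (hε₂ : 2 - lam₂ < ε) (hε₃ : ε < lam) {g : ℝ → ℝ} (hg : ContinuousOn g (Ioi 0)) {N : ℝ} (hN0 : 0 ≤ N)
    (hN : ∀ s, 0 < s → |g s| ≤ N * Real.exp (-ε * s)) {c₂ : ℝ} (hc₂ : 0 ≤ c₂)
    (hbound : ∀ (h : ℝ → ℝ) (N' : ℝ), ContinuousOn h (Ioi 0) → 0 ≤ N' →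
      (∀ s, 0 < s → |h s| ≤ N' * Real.exp (-ε * s)) →
      ∀ t, 0 < t → |greenSolI (fun t => sph lam₂ (hyp t)) (sphDecay lam₂) h t| ≤ c₂ * N' * Real.exp (-ε * t))
    (hq : |lam * (lam - 2) - lam₂ * (lam₂ - 2)| * c₂ < 1) {t : ℝ} (ht : 0 < t) :
    |greenSolI (fun t => sph lam (hyp t)) (sphDecay lam) g t - greenSolI (fun t => sph lam₂ (hyp t)) (sphDecay lam₂) g t|
      ≤ c₂ * (|lam * (lam - 2) - lam₂ * (lam₂ - 2)| * c₂) / (1 - |lam * (lam - 2) - lam₂ * (lam₂ - 2)| * c₂)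
        * N * Real.exp (-ε * t) :=
  abs_greenSolI_sub_le hlam hlam₂ hε₁ hε₂ hε₃ hg hN0 hN hc₂ hbound hq ht

/-- **The kernel resolvent identity** (row 511). -/
theorem kernel_resolvent_identity {lam lam₂ : ℝ} (hlam : 1 < lam) (hlam₂ : 1 < lam₂) {t s : ℝ} (ht : 0 < t)
    (hs : 0 < s) :
    (lam * (lam - 2) - lam₂ * (lam₂ - 2))
        * ∫ r in Ioi 0, sphGreenKernel lam t r * sphGreenKernel lam₂ r s * Real.sinh (2 * r)
      = sphGreenKernel lam t s - sphGreenKernel lam₂ t s :=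
  T5SU11KernelResolventIdentity.kernel_resolvent_identity hlam hlam₂ ht hs

/-- **The Green's kernel is monotone in the spectral parameter** (row 511). -/
theorem kernel_mono {lam lam₂ : ℝ} (hlam : 1 < lam) (hlam₂ : 1 < lam₂) (hle : lam₂ ≤ lam) {t s : ℝ} (ht : 0 < t)
    (hs : 0 < s) : sphGreenKernel lam₂ t s ≤ sphGreenKernel lam t s :=
  sphGreenKernel_mono hlam hlam₂ hle ht hs

end measure

end Summit.Ventures.HodgeRepro2.T5SU11RadialSummaryXII
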